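import Mathlib
import Summits.NavierStokesRegularity.FunctionalMining.NoGo.DirectorForm
import HarnessLib

/-!
# DirectorFormTension — (T3) quantitative bounds, the wall algebra with the MIRROR LAW jump, and the
# deficit-profile inequalities (T2) of the sharp-class line tension
# (nogo gen 24 staging `DirectorFormTension.STAGING.lean` 865f74d0478d10d4, §§4–6; filed by the prove seat in two
# parts under the 400-line cap: `NoGo/DirectorForm.lean` = §§1–3 (Rayleigh dictionary, DIRECTOR FORM, kernel
# criterion, LEMMA W), this file = §§4–6; declarations and the namespace `…SharpClass.DirectorForm` are
# byte-identical to the staging file; `SIEVELD.md` §3.4b (6), (8)(M), (8f)(o) (T2)/(T3))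

search for candidate a priori estimates; no regularity claim.

Setting: as in `NoGo/DirectorForm.lean` — wells `K(n) = I − 3 n⊗n` (`well n`), director mixtures
`M = mix θ n = Σ_i θ_i n_i⊗n_i`, `S₁ = I − 3M`, `lam1 M = TopEig.lam (flat M)`, `lamMin M = −lam1 (−M)`, and the
DIRECTOR FORM `λ₁(I − 3M) = 1 − 3 λ_min(M)` proved there.

What is kernel-checked here (elementary linear algebra and real analysis, `[ours]` = this cell's
bookkeeping of folklore facts; nothing below is specific to Navier–Stokes):
* §4 (T3) pointwise: `θ_min · λ_min(Σ n_i⊗n_i) ≤ λ_min(M)` (`lamMin_mix_ge`), the TILT BOUND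
  `λ_min(M) ≤ s²` when every director has `(n_i·τ)² = s²` for a unit `τ` and `Σ θ_i = 1` (`lamMin_mix_le_tilt`,
  with the exact value `ray_well_mix_tilt`: `τᵀ(I − 3M)τ = 1 − 3s²`), hence
  `3 θ_min λ_min(Σ n_i⊗n_i) ≤ 1 − λ₁(S₁) ≤ 3 s²` (`deficit_ge`, `deficit_le_tilt`);
* §5 the wall algebra of (6)/(8)(M): `lemmaW_jump` (`K(n₊) − K(n₋) = (3/2)[(n₋−n₊)⊗(n₋+n₊) + (n₋+n₊)⊗(n₋−n₊)]`),
  `wallNormals_orthogonal`, the MIRROR LAW jump `mirror_jump` (`n′ = n − 2(n·N)N ⇒ K(n′) − K(n) = sym(a⊗N)`,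
  `a = 12(n·N)(n − (n·N)N)`), `jumpAmp_dotProduct_normal` (`a ⊥ N`: the jump is divergence-free),
  `mirror_dotProduct_self/normal/of_orthogonal` (`|n′| = |n|`, `n′·N = −n·N`, and the COMMON TILT
  `n′·τ = n·τ` for walls containing `τ`), `ray_well` (`eᵀK(n)e = |e|² − 3(n·e)²`, the stretching rate of (E′)),
  `lam1_well` (`λ₁(K(n)) = 1` in `ℝ³`, LEMMA W with `θ₂ = 0`);
* §6 (T2) the deficit profile `1 − λ^q` on `[0, 1]`: nonnegative, `≤ q(1 − λ)` for `q ≥ 1` (Bernoulli),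
  non-decreasing in `q ≥ 0`, zero iff `λ = 1` (`q > 0`); integrated against any measure,
  `lineTension q λ μ := 2∫⁻ (1 − λ^q) dμ` is monotone in `q`, `≤ q · lineTension 1`, and vanishes iff `λ = 1`
  a.e. (`lineTension_eq_zero_iff`, with an `AEMeasurable` binder).
NOT checked by Lean (prose, SIEVELD §3.4b (8f)): THEOREM T (`κ_q(e) = 2∫(1 − λ₁(S₁)^q) dA` from the heat
semigroup), the (⇒) half of the free-edge criterion (E) (it uses the face geometry around the edge), the clause
'coplanar iff `s_e = 0`' of (T1) (latitude circles + the loop law), the Cameron–Martin constant `0.146` of (T3),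
and anything about Navier–Stokes.  No verdict of the cell changes.
-/

noncomputable section

open Finset Set Matrix MeasureTheory
open scoped Matrix ENNReal

namespace Summit.NavierStokesRegularity.FunctionalMining.SharpClass.DirectorForm

open TopEig

variable {d : Type*} [Fintype d] [DecidableEq d] [Nonempty d]
variable {ι : Type*} [Fintype ι]

/-! ## 4. (T3): the quantitative bounds `3 θ_min λ_min(Σ n_i⊗n_i) ≤ 1 − λ₁(S₁) ≤ 3 s²` -/

/-- `M ⪰ θ_min · Σ_i n_i⊗n_i` in Rayleigh form, hence `θ_min λ_min(Σ n_i⊗n_i) ≤ λ_min(M)`. [ours] -/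
theorem lamMin_mix_ge {θ : ι → ℝ} {θmin : ℝ} (hmin : 0 ≤ θmin) (hθ : ∀ i, θmin ≤ θ i) (n : ι → d → ℝ) :
    θmin * lamMin (mix (fun _ => (1 : ℝ)) n) ≤ lamMin (mix θ n) := by
  refine le_lamMin fun e he => ?_
  calc θmin * lamMin (mix (fun _ => (1 : ℝ)) n)
      ≤ θmin * (e ⬝ᵥ mix (fun _ => (1 : ℝ)) n *ᵥ e) :=
        mul_le_mul_of_nonneg_left (lamMin_le_ray _ he) hmin
    _ = ∑ i, θmin * (n i ⬝ᵥ e) ^ 2 := by rw [ray_mix, Finset.mul_sum]; simp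
    _ ≤ ∑ i, θ i * (n i ⬝ᵥ e) ^ 2 :=
        Finset.sum_le_sum fun i _ => mul_le_mul_of_nonneg_right (hθ i) (sq_nonneg _)
    _ = e ⬝ᵥ mix θ n *ᵥ e := (ray_mix θ n e).symm

/-- **(T3) pointwise lower bound** on the deficit: `3 θ_min λ_min(Σ n_i⊗n_i) ≤ 1 − λ₁(I − 3M)`. [ours] -/
theorem deficit_ge {θ : ι → ℝ} {θmin : ℝ} (hmin : 0 ≤ θmin) (hθ : ∀ i, θmin ≤ θ i) (n : ι → d → ℝ) :
    3 * (θmin * lamMin (mix (fun _ => (1 : ℝ)) n)) ≤ 1 - lam1 (1 - (3 : ℝ) • mix θ n) := by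
  rw [lam1_one_sub_three_smul]; linarith [lamMin_mix_ge hmin hθ n]

omit [Nonempty d] in
/-- COMMON TILT test vector: if every director has `(n_i·τ)² = s²` and `Σ θ_i = 1` then
`τᵀ(I − 3M)τ = |τ|² − 3s²`. [ours] -/
theorem ray_well_mix_tilt {θ : ι → ℝ} (hθ : ∑ i, θ i = 1) {n : ι → d → ℝ} {τ : d → ℝ} {s : ℝ}
    (hs : ∀ i, (n i ⬝ᵥ τ) ^ 2 = s ^ 2) :
    τ ⬝ᵥ (1 - (3 : ℝ) • mix θ n) *ᵥ τ = τ ⬝ᵥ τ - 3 * s ^ 2 := by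
  rw [ray_one_sub_smul, ray_mix]
  simp only [hs, ← Finset.sum_mul, hθ, one_mul]

omit [DecidableEq d] [Nonempty d] in
/-- **Tilt bound**: under the common tilt `s`, `λ_min(M) ≤ s²`. [ours] -/
theorem lamMin_mix_le_tilt {θ : ι → ℝ} (hθ : ∑ i, θ i = 1) {n : ι → d → ℝ} {τ : d → ℝ} (hτ : τ ⬝ᵥ τ = 1)
    {s : ℝ} (hs : ∀ i, (n i ⬝ᵥ τ) ^ 2 = s ^ 2) : lamMin (mix θ n) ≤ s ^ 2 := by
  have h := lamMin_le_ray (mix θ n) hτ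
  rw [ray_mix] at h
  simpa only [hs, ← Finset.sum_mul, hθ, one_mul] using h

/-- **(T3) pointwise upper bound**: the deficit density is `O(s²)`: `1 − λ₁(I − 3M) ≤ 3 s²`. [ours] -/
theorem deficit_le_tilt {θ : ι → ℝ} (hθ : ∑ i, θ i = 1) {n : ι → d → ℝ} {τ : d → ℝ} (hτ : τ ⬝ᵥ τ = 1)
    {s : ℝ} (hs : ∀ i, (n i ⬝ᵥ τ) ^ 2 = s ^ 2) : 1 - lam1 (1 - (3 : ℝ) • mix θ n) ≤ 3 * s ^ 2 := by
  rw [lam1_one_sub_three_smul]; linarith [lamMin_mix_le_tilt hθ hτ hs]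

/-! ## 5. Wall algebra: LEMMA W's jump identity and the MIRROR LAW (8)(M) -/

omit [Fintype d] [Nonempty d] in
/-- `K(n₊) − K(n₋) = 3(n₋⊗n₋ − n₊⊗n₊)`. [ours] -/
theorem well_sub_well (np nm : d → ℝ) :
    well np - well nm = (3 : ℝ) • (vecMulVec nm nm - vecMulVec np np) := by
  simp only [well, smul_sub]
  abel

omit [Fintype d] [DecidableEq d] [Nonempty d] in
/-- `(a−b)⊗(a+b) + (a+b)⊗(a−b) = 2(a⊗a − b⊗b)`. [folklore] -/
theorem vecMulVec_sub_add (a b : d → ℝ) :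
    vecMulVec (a - b) (a + b) + vecMulVec (a + b) (a - b) = (2 : ℝ) • (vecMulVec a a - vecMulVec b b) := by
  ext i j
  simp [vecMulVec_apply, Matrix.add_apply, Matrix.sub_apply, Matrix.smul_apply]
  ring

omit [Fintype d] [Nonempty d] in
/-- **LEMMA W, jump identity** (SIEVELD §3.4b (6)): any two wells differ by a symmetrised rank-one matrix,
`K(n₊) − K(n₋) = (3/2)[(n₋−n₊)⊗(n₋+n₊) + (n₋+n₊)⊗(n₋−n₊)]`. [ours] -/
theorem lemmaW_jump (np nm : d → ℝ) :
    well np - well nm = (3 / 2 : ℝ) • (vecMulVec (nm - np) (nm + np) + vecMulVec (nm + np) (nm - np)) := by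
  rw [well_sub_well, vecMulVec_sub_add, smul_smul]
  norm_num

omit [DecidableEq d] [Nonempty d] in
/-- The two candidate wall normals `n₋ ± n₊` are orthogonal for unit directors (so the jump `sym(a⊗ν)` has
`a ⊥ ν`: divergence-free). [ours] -/
theorem wallNormals_orthogonal {np nm : d → ℝ} (hp : np ⬝ᵥ np = 1) (hm : nm ⬝ᵥ nm = 1) :
    (nm - np) ⬝ᵥ (nm + np) = 0 := by
  rw [sub_dotProduct, dotProduct_add, dotProduct_add, hm, hp, dotProduct_comm np nm]; ring

omit [DecidableEq d] [Nonempty d] in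
/-- The mirror image `R_N n = n − 2(n·N)N` of a director in the wall with unit normal `N`. [ours, bookkeeping] -/
def mirror (N n : d → ℝ) : d → ℝ := n - (2 * (n ⬝ᵥ N)) • N

omit [DecidableEq d] [Nonempty d] in
/-- The Hadamard amplitude `a = 12(n·N)(n − (n·N)N)` of the mirror-law jump. [ours, bookkeeping] -/
def jumpAmp (N n : d → ℝ) : d → ℝ := (12 * (n ⬝ᵥ N)) • (n - (n ⬝ᵥ N) • N)

omit [Nonempty d] in
/-- **MIRROR LAW jump** (SIEVELD §3.4b (8)(M)): with `n′ = n − 2(n·N)N`,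
`K(n′) − K(n) = 3(n⊗n − n′⊗n′) = sym(a⊗N) = ½(a⊗N + N⊗a)`, `a = 12(n·N)(n − (n·N)N)` — a polynomial identity
(no normalisation needed). [ours] -/
theorem mirror_jump (N n : d → ℝ) :
    well (mirror N n) - well n = (1 / 2 : ℝ) • (vecMulVec (jumpAmp N n) N + vecMulVec N (jumpAmp N n)) := by
  rw [well_sub_well]
  ext i j
  simp [mirror, jumpAmp, vecMulVec_apply, Matrix.sub_apply, Matrix.add_apply, Matrix.smul_apply]
  ring

omit [DecidableEq d] [Nonempty d] in
/-- `a ⊥ N` for a unit wall normal: the mirror-law jump `a⊗N` is trace-free / divergence-free. [ours] -/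
theorem jumpAmp_dotProduct_normal {N : d → ℝ} (hN : N ⬝ᵥ N = 1) (n : d → ℝ) : jumpAmp N n ⬝ᵥ N = 0 := by
  simp only [jumpAmp, smul_dotProduct, sub_dotProduct, hN, smul_eq_mul]; ring

omit [DecidableEq d] [Nonempty d] in
/-- The mirror image of a director has the same length. [folklore] -/
theorem mirror_dotProduct_self {N : d → ℝ} (hN : N ⬝ᵥ N = 1) (n : d → ℝ) :
    mirror N n ⬝ᵥ mirror N n = n ⬝ᵥ n := by
  simp only [mirror, sub_dotProduct, dotProduct_sub, smul_dotProduct, dotProduct_smul, hN, smul_eq_mul,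
    dotProduct_comm N n]
  ring

omit [DecidableEq d] [Nonempty d] in
/-- `n′·N = −n·N`: both cells of a wall see the normal at the same angle. [folklore] -/
theorem mirror_dotProduct_normal {N : d → ℝ} (hN : N ⬝ᵥ N = 1) (n : d → ℝ) :
    mirror N n ⬝ᵥ N = -(n ⬝ᵥ N) := by
  simp only [mirror, sub_dotProduct, smul_dotProduct, hN, smul_eq_mul]; ring

omit [DecidableEq d] [Nonempty d] in
/-- **COMMON TILT** (SIEVELD §3.4b (8f)(i)): a wall containing the direction `τ` (`N ⊥ τ`) preserves `n·τ`,
so all cells around a junction line have the same tilt `|n_c·τ|`. [ours] -/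
theorem mirror_dotProduct_of_orthogonal {N τ : d → ℝ} (hτ : N ⬝ᵥ τ = 0) (n : d → ℝ) :
    mirror N n ⬝ᵥ τ = n ⬝ᵥ τ := by
  simp [mirror, sub_dotProduct, smul_dotProduct, hτ]

omit [Nonempty d] in
/-- `eᵀK(n)e = |e|² − 3(n·e)²`: the stretching rate of a cell in direction `e` ((E′): rate `1` along a free
edge, `e ⊥ n`). [ours] -/
theorem ray_well (n e : d → ℝ) : e ⬝ᵥ well n *ᵥ e = e ⬝ᵥ e - 3 * (n ⬝ᵥ e) ^ 2 := by
  rw [well, ray_one_sub_smul, ray_vecMulVec, sq]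

/-- Every well has top Rayleigh value `λ₁(K(n)) = 1` in `ℝ³` (any `n`; LEMMA W with `θ₂ = 0`). [ours] -/
theorem lam1_well (n : Fin 3 → ℝ) : lam1 (well n) = 1 := by
  have h := lemmaW zero_le_one le_rfl n n
  simpa [well] using h

/-! ## 6. (T2): the deficit profile `1 − λ^q` and the integrated line tension -/

section Deficit

/-- `0 ≤ 1 − λ^q` on `[0, 1]` for `q ≥ 0`. [folklore] -/
theorem deficit_nonneg {l q : ℝ} (hl0 : 0 ≤ l) (hl1 : l ≤ 1) (hq : 0 ≤ q) : 0 ≤ 1 - l ^ q := by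
  linarith [Real.rpow_le_one hl0 hl1 hq]

/-- **Bernoulli**: `1 − λ^q ≤ q(1 − λ)` for `λ ≥ 0`, `q ≥ 1` (so `κ_q ≤ q κ₁`). [folklore] -/
theorem deficit_le_mul {l q : ℝ} (hl0 : 0 ≤ l) (hq : 1 ≤ q) : 1 - l ^ q ≤ q * (1 - l) := by
  have h := one_add_mul_self_le_rpow_one_add (s := l - 1) (by linarith) hq
  rw [show (1 : ℝ) + (l - 1) = l by ring] at h
  linarith

/-- **Monotonicity in `q`**: `1 − λ^q ≤ 1 − λ^{q′}` for `0 ≤ q ≤ q′`, `λ ∈ [0, 1]` (so `κ_q` is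
non-decreasing in `q`). [folklore] -/
theorem deficit_mono {l q q' : ℝ} (hl0 : 0 ≤ l) (hl1 : l ≤ 1) (hq : 0 ≤ q) (hqq : q ≤ q') :
    1 - l ^ q ≤ 1 - l ^ q' := by
  linarith [Real.rpow_le_rpow_of_exponent_ge' hl0 hl1 hq hqq]

/-- The deficit vanishes exactly at the wells' value `λ = 1` (`q > 0`). [folklore] -/
theorem deficit_eq_zero_iff {l q : ℝ} (hl0 : 0 ≤ l) (hl1 : l ≤ 1) (hq : 0 < q) :
    1 - l ^ q = 0 ↔ l = 1 := by
  constructor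
  · intro h
    by_contra hne
    have hlt : l ^ q < 1 := Real.rpow_lt_one hl0 (lt_of_le_of_ne hl1 hne) hq
    linarith
  · rintro rfl; simp

variable {α : Type*} [MeasurableSpace α]

/-- The integrated deficit `κ_q(λ; μ) := 2 ∫⁻ (1 − λ(x)^q) dμ(x)` (THEOREM T's form of the line tension,
with `λ = λ₁(S₁)` on the cross-section and `μ` = area; here any measure). [ours, bookkeeping] -/
def lineTension (q : ℝ) (lam₁ : α → ℝ) (μ : Measure α) : ℝ≥0∞ :=
  2 * ∫⁻ x, ENNReal.ofReal (1 - lam₁ x ^ q) ∂μ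

/-- **(T2)a**: `κ_q` is non-decreasing in `q ≥ 0` (profile in `[0, 1]`). [ours] -/
theorem lineTension_mono {lam₁ : α → ℝ} (h01 : ∀ x, 0 ≤ lam₁ x ∧ lam₁ x ≤ 1) (μ : Measure α) {q q' : ℝ}
    (hq : 0 ≤ q) (hqq : q ≤ q') : lineTension q lam₁ μ ≤ lineTension q' lam₁ μ := by
  unfold lineTension
  exact mul_le_mul' le_rfl
    (lintegral_mono fun x => ENNReal.ofReal_le_ofReal (deficit_mono (h01 x).1 (h01 x).2 hq hqq))

/-- **(T2)b**: `κ_q ≤ q · κ₁` for `q ≥ 1`. [ours] -/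
theorem lineTension_le_mul {lam₁ : α → ℝ} (h0 : ∀ x, 0 ≤ lam₁ x) (μ : Measure α) {q : ℝ} (hq : 1 ≤ q) :
    lineTension q lam₁ μ ≤ ENNReal.ofReal q * lineTension 1 lam₁ μ := by
  unfold lineTension
  have hq0 : 0 ≤ q := by linarith
  calc 2 * ∫⁻ x, ENNReal.ofReal (1 - lam₁ x ^ q) ∂μ
      ≤ 2 * ∫⁻ x, ENNReal.ofReal q * ENNReal.ofReal (1 - lam₁ x ^ (1 : ℝ)) ∂μ := by
        refine mul_le_mul' le_rfl (lintegral_mono fun x => ?_)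
        rw [Real.rpow_one, ← ENNReal.ofReal_mul hq0]
        exact ENNReal.ofReal_le_ofReal (deficit_le_mul (h0 x) hq)
    _ = ENNReal.ofReal q * (2 * ∫⁻ x, ENNReal.ofReal (1 - lam₁ x ^ (1 : ℝ)) ∂μ) := by
        rw [lintegral_const_mul' _ _ ENNReal.ofReal_ne_top]; ring

/-- **(T1) integrated**: `κ_q = 0` iff `λ = 1` almost everywhere (profile in `[0, 1]`, `q > 0`,
`λ` a.e.-measurable). [ours] -/
theorem lineTension_eq_zero_iff {lam₁ : α → ℝ} (h01 : ∀ x, 0 ≤ lam₁ x ∧ lam₁ x ≤ 1) {μ : Measure α}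
    (hmeas : AEMeasurable lam₁ μ) {q : ℝ} (hq : 0 < q) :
    lineTension q lam₁ μ = 0 ↔ ∀ᵐ x ∂μ, lam₁ x = 1 := by
  unfold lineTension
  have hf : AEMeasurable (fun x => ENNReal.ofReal (1 - lam₁ x ^ q)) μ :=
    (aemeasurable_const.sub (hmeas.pow_const q)).ennreal_ofReal
  rw [mul_eq_zero, lintegral_eq_zero_iff' hf]
  simp only [two_ne_zero, false_or]
  refine ⟨fun h => ?_, fun h => ?_⟩
  · filter_upwards [h] with x hx
    have hx' : 1 - lam₁ x ^ q ≤ 0 := ENNReal.ofReal_eq_zero.mp hx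
    exact (deficit_eq_zero_iff (h01 x).1 (h01 x).2 hq).mp
      (le_antisymm hx' (deficit_nonneg (h01 x).1 (h01 x).2 hq.le))
  · filter_upwards [h] with x hx
    show ENNReal.ofReal (1 - lam₁ x ^ q) = (0 : α → ℝ≥0∞) x
    rw [hx]; simp

end Deficit

end Summit.NavierStokesRegularity.FunctionalMining.SharpClass.DirectorForm

end
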